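import Summits.RiemannHypothesis.RiemannHypothesis.Theorems.TiltedLandingLaw421R3RateGlue2A
import Summits.RiemannHypothesis.RiemannHypothesis.Theorems.TiltedLandingLaw421R3ColumnImmunity

/-! # TOUCH class, rung R1u: `UncoveredChildLawJ` (statement, OPEN) and the COVER EXCLUSION lemma (proved) — lens-2 g4/g5, ⟨33346⟩, director (CA585) W2 / (CA598)

(W2) STATEMENT ONLY (HOLD rule: it lands when a proof elaborates): `UncoveredChildLawJ` = R1a′ `RhW08.BurgersRateG3.FarChildExistsLawSep` with the
separation binder C′ replaced by UNCOVERED («every other zero `z` of `f⁽ʲ⁾` has `Im z² ≤ Im v² + (Re v − Re z)²`, i.e. `v` is not inside the open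
Jensen disc of any other zero») and the conclusion weakened to «a MOVING upper child `w` (`f⁽ʲ⁺¹⁾ w = 0`, `f⁽ʲ⁾ w ≠ 0`) STRICTLY BELOW `v`
(`0 < Im w < Im v`) nested under some zero `z` of `f⁽ʲ⁾` whose closed disc meets `v`'s (`|Re z − Re v| ≤ Im z + Im v`; `z = v` allowed)» — the first
shell of the cluster union `Ū` of `lens2/TOUCH-MEMO-v2.md` §1.
(v2 = v1 + crit-1 CUT 19 sharpening, director (CA598)): the shell zero `z` is AT LEAST AS TALL as `v` (`v.im ≤ z.im`: `z` is `v` itself or a genuine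
taller toucher, never a lower non-band zero) in BOTH `UncoveredChildLawJ` and `IsolatedLowChildLawJ`; nothing else changed.

(CE2 LEGALITY, PROVED) `uncovered_of_lateral_isolation`: on an `EngineHyps5 2` frame (`2·Hs ≤ R`, strip `|Im z| ≤ Hs` for the zeros of `f⁽ʲ⁾`) the
lateral `R/2`-isolation binder that R1a′ / R1t / R1t′ all carry FORCES `v` UNCOVERED: a zero `z ∉ {v, v̄}` has `|Re z − Re v| ≥ R/2 ≥ Hs ≥ |Im z|`.  Hence the
charged ANTI-DROP frame CE2 of the memo (`v = 0.3i` covered by the toucher `0.075 + 0.54i`) is NOT a case of `ToucherLaw` / `TouchChildLaw`: it is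
EXCLUDED by their own isolation binder (verdict «excluded by ⟨lateral R/2 isolation ∧ 2Hs ≤ R⟩», not «refuted»); and R1u's UNCOVERED binder is FREE on
every R1t frame (`uncoveredChildLawJ_iff_isolated` records the equivalence of R1u with its binder-free form `IsolatedLowChildLawJ`).
Consequence for the mechanism (memo §3): on every legal touched level `Im T_others(v) ≤ 0` (all pair terms Jensen-signed at an uncovered `v`, teeth negative,
tilt real), so to first order `v` descends at ≥ the isolated rate — consistent with instr-1's «no hovering» (TA v2 §7) and with `ToucherLaw`'s constant
(`(1+θ)² ≤ 5/4` at first order; record `θ = 1/200`).  Sorry-free; axioms standard; no registry stub is touched.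
Nothing here bears on the truth of RH; RH is not proved; R1t / R1u / `stub_childExistsSep` / 33346 / 33347 OPEN; checked ≠ proved. -/

noncomputable section

open Complex Metric Set
open scoped Real ComplexConjugate

namespace RhW08.ChildCount

open RhIdea6.G17.W07C7 RhIdea6.G17.W07C7.Rev6 RhIdea6.G18.W07C8.Law421BirthS RhIdea6.G19.W07C11.Seam RhIdea6.G20.W07C12.Frac
  RhIdea6.G20.W07C12.StColP RhW07.C12.FieldSplit RhW08.Round1 RhW08.StSwap RhW08.Round2 RhW08.QuadW RhW08.SealSwapQ in
open RhW08.SealSwap (PBot) in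
/-- (LAW R1u — UNCOVERED LOW CHILD; typed, OPEN; director (CA585) W2) at a charged level whose lowest band state `v` is laterally `R/2`-isolated and
UNCOVERED (no other zero's open Jensen disc contains `v`), `f⁽ʲ⁺¹⁾` has a MOVING zero `w` strictly below `v` (`0 < Im w < Im v`, `f⁽ʲ⁾ w ≠ 0`) nested
under a zero `z` of `f⁽ʲ⁾` AT LEAST AS TALL as `v` (`v.im ≤ z.im`, CUT 19) whose closed disc meets `v`'s (first shell of the cluster; `z = v` allowed).  Prices: instr-1 P1 (prediction ANTIDROP ⊂ COV ⇒
law-true on TOUCHER / KIT-1); lens-2 census UNCOVERED anti-drop 0/167; CE1 child `0.067 + 0.2945i` (Im w = 0.975·Im v, in the toucher's disc). -/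
def UncoveredChildLawJ : Prop :=
  ∀ (η : ℝ) (f : ℂ → ℂ) (x₀ s hmax R Hs : ℝ) (B : ℕ), EngineHyps5 2 η f x₀ s hmax R Hs B →
    ∀ (j : ℕ) (v : ℂ), Charged (PTrkSQ PBot) StTrkDQ ReadyR2 η f x₀ s hmax R Hs B j →
      IsLowest StTrkDQ η f x₀ s hmax R Hs B j v →
      (∀ z : ℂ, iteratedDeriv j f z = 0 → |z.re - v.re| < R / 2 → z = v ∨ z = conj v) →
      (∀ z : ℂ, iteratedDeriv j f z = 0 → z ≠ v → z ≠ conj v → z.im ^ 2 ≤ v.im ^ 2 + (v.re - z.re) ^ 2) →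
      ∃ w z : ℂ, iteratedDeriv (j + 1) f w = 0 ∧ iteratedDeriv j f w ≠ 0 ∧ 0 < w.im ∧ w.im < v.im ∧
        iteratedDeriv j f z = 0 ∧ 0 < z.im ∧ v.im ≤ z.im ∧ |z.re - v.re| ≤ z.im + v.im ∧ ‖w - (z.re : ℂ)‖ ≤ z.im

open RhIdea6.G17.W07C7 RhIdea6.G17.W07C7.Rev6 RhIdea6.G18.W07C8.Law421BirthS RhIdea6.G19.W07C11.Seam RhIdea6.G20.W07C12.Frac
  RhIdea6.G20.W07C12.StColP RhW07.C12.FieldSplit RhW08.Round1 RhW08.StSwap RhW08.Round2 RhW08.QuadW RhW08.SealSwapQ in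
open RhW08.SealSwap (PBot) in
/-- (LAW R1u, binder-free form) the same law WITHOUT the UNCOVERED binder — equivalent to `UncoveredChildLawJ` on `EngineHyps5 2` frames by
`uncovered_of_lateral_isolation` (see `uncoveredChildLawJ_iff_isolated`). -/
def IsolatedLowChildLawJ : Prop :=
  ∀ (η : ℝ) (f : ℂ → ℂ) (x₀ s hmax R Hs : ℝ) (B : ℕ), EngineHyps5 2 η f x₀ s hmax R Hs B →
    ∀ (j : ℕ) (v : ℂ), Charged (PTrkSQ PBot) StTrkDQ ReadyR2 η f x₀ s hmax R Hs B j →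
      IsLowest StTrkDQ η f x₀ s hmax R Hs B j v →
      (∀ z : ℂ, iteratedDeriv j f z = 0 → |z.re - v.re| < R / 2 → z = v ∨ z = conj v) →
      ∃ w z : ℂ, iteratedDeriv (j + 1) f w = 0 ∧ iteratedDeriv j f w ≠ 0 ∧ 0 < w.im ∧ w.im < v.im ∧
        iteratedDeriv j f z = 0 ∧ 0 < z.im ∧ v.im ≤ z.im ∧ |z.re - v.re| ≤ z.im + v.im ∧ ‖w - (z.re : ℂ)‖ ≤ z.im

open RhIdea6.G17.W07C7 RhIdea6.G17.W07C7.Rev6 RhIdea6.G18.W07C8.Law421BirthS RhIdea6.G19.W07C11.Seam RhIdea6.G20.W07C12.Frac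
  RhIdea6.G20.W07C12.StColP RhW07.C12.FieldSplit RhW08.Round1 RhW08.StSwap RhW08.Round2 RhW08.QuadW RhW08.SealSwapQ in
/-- ★ **COVER EXCLUSION** (CE2 legality, PROVED): on an `EngineHyps5 2` frame, if `f⁽ʲ⁾ ≢ 0` and the zero `v` is laterally `R/2`-isolated
(every zero of `f⁽ʲ⁾` with `|Re z − Re v| < R/2` is `v` or `v̄`), then `v` is UNCOVERED: every other zero `z` satisfies `Im z² ≤ Im v² + (Re v − Re z)²`
(indeed `|Im z| ≤ Hs ≤ R/2 ≤ |Re z − Re v|`).  So a COVERING taller toucher — the anti-drop configuration CE2 — never meets the isolation binder of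
R1a′ / R1t / R1t′ / R1u. -/
theorem uncovered_of_lateral_isolation {η : ℝ} {f : ℂ → ℂ} {x₀ s hmax R Hs : ℝ} {B : ℕ} (hE : EngineHyps5 2 η f x₀ s hmax R Hs B)
    {j : ℕ} (hnz : iteratedDeriv j f ≠ 0) {v : ℂ}
    (hiso : ∀ z : ℂ, iteratedDeriv j f z = 0 → |z.re - v.re| < R / 2 → z = v ∨ z = conj v) :
    ∀ z : ℂ, iteratedDeriv j f z = 0 → z ≠ v → z ≠ conj v → z.im ^ 2 ≤ v.im ^ 2 + (v.re - z.re) ^ 2 := by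
  intro z hz hzv hzc
  have hHsR : 2 * Hs ≤ R := hE.2.2.2.2.2.2.2.2.2.1
  have hzim : |z.im| ≤ Hs := RhW08.Column.abs_im_le_of_level hE hnz hz
  have hfar : R / 2 ≤ |z.re - v.re| := by
    refine le_of_not_gt fun hlt => ?_
    rcases hiso z hz hlt with h | h
    · exact hzv h
    · exact hzc h
  have h1 : |z.im| ≤ |z.re - v.re| := by linarith
  have h2 : z.im ^ 2 ≤ (z.re - v.re) ^ 2 := sq_le_sq.mpr h1
  have h3 : (z.re - v.re) ^ 2 = (v.re - z.re) ^ 2 := by ring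
  nlinarith [sq_nonneg v.im]

open RhIdea6.G17.W07C7 RhIdea6.G17.W07C7.Rev6 RhIdea6.G18.W07C8.Law421BirthS RhIdea6.G19.W07C11.Seam RhIdea6.G20.W07C12.Frac
  RhIdea6.G20.W07C12.StColP RhW07.C12.FieldSplit RhW08.Round1 RhW08.StSwap RhW08.Round2 RhW08.QuadW RhW08.SealSwapQ in
/-- ★ The same exclusion phrased on TOUCHERS: under lateral `R/2`-isolation every zero `z ∉ {v, v̄}` of `f⁽ʲ⁾` lies at lateral distance `≥ R/2 ≥ Hs ≥ |Im z|`
from `v`; in particular a disc-toucher (`|Re v − Re z| ≤ Im v + Im z`) has `R/2 ≤ Im v + Im z` and does NOT cover `v`. -/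
theorem toucher_far_of_lateral_isolation {η : ℝ} {f : ℂ → ℂ} {x₀ s hmax R Hs : ℝ} {B : ℕ} (hE : EngineHyps5 2 η f x₀ s hmax R Hs B)
    {j : ℕ} (hnz : iteratedDeriv j f ≠ 0) {v : ℂ}
    (hiso : ∀ z : ℂ, iteratedDeriv j f z = 0 → |z.re - v.re| < R / 2 → z = v ∨ z = conj v)
    {z : ℂ} (hz : iteratedDeriv j f z = 0) (hzv : z ≠ v) (hzc : z ≠ conj v) :
    R / 2 ≤ |z.re - v.re| ∧ |z.im| ≤ Hs ∧ Hs ≤ R / 2 := by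
  have hHsR : 2 * Hs ≤ R := hE.2.2.2.2.2.2.2.2.2.1
  have hzim : |z.im| ≤ Hs := RhW08.Column.abs_im_le_of_level hE hnz hz
  have hfar : R / 2 ≤ |z.re - v.re| := by
    refine le_of_not_gt fun hlt => ?_
    rcases hiso z hz hlt with h | h
    · exact hzv h
    · exact hzc h
  exact ⟨hfar, hzim, by linarith⟩

open RhIdea6.G17.W07C7 RhIdea6.G17.W07C7.Rev6 RhIdea6.G18.W07C8.Law421BirthS RhIdea6.G19.W07C11.Seam RhIdea6.G20.W07C12.Frac
  RhIdea6.G20.W07C12.StColP RhW07.C12.FieldSplit RhW08.Round1 RhW08.StSwap RhW08.Round2 RhW08.QuadW RhW08.SealSwapQ in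
open RhW08.SealSwap (PBot) in
/-- ★ R1u's UNCOVERED binder is FREE on `EngineHyps5 2` frames: the law with and without it are EQUIVALENT. -/
theorem uncoveredChildLawJ_iff_isolated : UncoveredChildLawJ ↔ IsolatedLowChildLawJ := by
  constructor
  · intro h η f x₀ s hmax R Hs B hE j v hC hlow hiso
    have hnz : iteratedDeriv j f ≠ 0 := hlow.1.1
    exact h η f x₀ s hmax R Hs B hE j v hC hlow hiso (uncovered_of_lateral_isolation hE hnz hiso)
  · intro h η f x₀ s hmax R Hs B hE j v hC hlow hiso _
    exact h η f x₀ s hmax R Hs B hE j v hC hlow hiso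

end RhW08.ChildCount
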